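import Summits.QuantumFields.YangMills.Theorems.AllWindowsColdBoxBoxHighLineK4PrimeRowR3R4

/-!
# K4′(b) ROW R4′ — `CROSS_P(c_x, c_y; P, N)` by Hölder (4,4,4,4) with CENTRED plaquette slots (the fix of row R4's exponent at the point of record)
# (w4 g30's ⚠⚠ flag 2026-08-30T01:19:50Z, planner ym-idea-2 g18 RULING 01:20:54Z «R4′ → w2»; LEAD g78's term table `ym-idea-1/g78-K4PRIME-TERM-TABLE.md` row R4;
# hypothesis hK4 of ✓`landauThirdOrder_of_sizes₂`, LINE-20 U5 ⟨stmt-QuantumFields-24336⟩; U5 prep, helper-grade; U5 is UNSTAFFED)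

Width seat `ym-line-sfw-p2-w2` (g33).  ✓`GaussNormalForm.abs_cross_muSet_rowR4_le` (✓p754326) priced the two plaquette slots by their SUP `116s²`; at the point of record
`κ₃ = 1/8 − θ/4` that gives rel-exponents `14.25θ − 1.125` (ghost part of `ν`) / `11.75θ − 0.875` (quintic part) — NOT negative on `(0.0745, 1/10)`.  Pricing the
plaquette slots by their CENTRED restricted fourth moments instead (w5 g24's ✓`gaussAvg_indicator_mul_chartPlaqCost_sub_mean_pow_four_le`:
`E₀[1_D(c_z − E₀ℓ_z²)⁴] ≤ C_P((1+log H)⁴/β⁴ + s⁶/β³)`, i.e. `‖c̃‖₄ ≍ L/β` instead of `116s²`) in the SAME Hölder (4,4,4,4) bound of fcl-p3 g27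
(✓`GaussRestrict.abs_cross_muSet_zero_le_gaussAvg`, re-centring constants free) gives

★★ `abs_cross_muSet_rowR4_centred_le`: `|CROSS_P(c_x, c_y; P, N)| ≤ 128·√(C_P((1+log H)⁴/β⁴ + s⁶/β³))·(√(√(C_A·(B²H⁴(1+log H)³/β)²))·ν)`

(same letters as R4: `E := Tilt.tiltExp μ_D P 0`, `P` first, generic measurable `N` with `sup_D|N| ≤ ν`; `C_A` = w5's ✓`gaussAvg_indicator_mul_tripleFormSum_pow_four_le`).
REL at `κ₃ = 1/8 − θ/4` (×β²H⁸, `s = β^{κ₃−1/2}`): `β²H⁸·(L²/β²)·(B·H²L^{3/2}β^{−1/2})·ν = H¹⁰β^{−1/2}·ν·polylog`; with `ν = C·H⁶L^m s³` (ghost) resp. `C·βH⁴s⁵` (quintic):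
exponent rows **`15.25θ − 1.625 < 0`** and **`12.75θ − 1.375 < 0`**, both for EVERY `θ < 1/10` ✓ (the `s³β^{−3/2}` branch of `√(…+s⁶/β³)` is smaller).

Tree only; no definitions; standard axioms.  HONEST LABEL: helper-grade row of hK4 for an UNSTAFFED stub; U5, ⟨24336⟩, ⟨24004⟩ and the seat's own crux ⟨22884⟩ remain OPEN;
route AllWindowsColdBox is DRAFT; no crux, rung or summit is proved; **the Yang–Mills mass gap is NOT proved by this file; no summit is proved by a line.**
-/

set_option autoImplicit false

noncomputable section

open MeasureTheory Set
open Literature.Probability.LatticeModels (Site)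
open Literature.MathematicalPhysics.QuantumLattice (plaquettesTouching ZdPlaquette)
open Literature.MathematicalPhysics.QuantumFieldTheory.AxialGauge (boxEdges)
open Summit.QuantumFields.YangMills.Theorems.WeakCouplingRates (plaq12At)

namespace Summit.QuantumFields.YangMills.Theorems.AllWindowsColdBoxBoxHighLine

namespace GaussNormalForm

variable {H : ℕ} {β : ℝ}

/-- The `√√` arithmetic with two slots priced by a common bound `A` (not a fourth power): `A₁, A₂ ≤ A`, `A₃ ≤ u`, `0 ≤ A₄ ≤ v⁴`, `v ≥ 0` ⇒
`4·√(√(32A₁)·√(32A₂))·√(√(32A₃)·√(32A₄)) ≤ 128·√A·(√(√u)·v)`. -/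
theorem sqrt_sqrt_bound' {A₁ A₂ A₃ A₄ A u v : ℝ} (h1 : 0 ≤ A₁) (h4 : 0 ≤ A₄) (hv : 0 ≤ v)
    (b1 : A₁ ≤ A) (b2 : A₂ ≤ A) (b3 : A₃ ≤ u) (b4 : A₄ ≤ v ^ 4) :
    4 * (Real.sqrt (Real.sqrt (32 * A₁) * Real.sqrt (32 * A₂)) * Real.sqrt (Real.sqrt (32 * A₃) * Real.sqrt (32 * A₄))) ≤
      128 * Real.sqrt A * (Real.sqrt (Real.sqrt u) * v) := by
  have hsq32 : Real.sqrt 32 * Real.sqrt 32 = 32 := Real.mul_self_sqrt (by norm_num)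
  have hA : 0 ≤ A := h1.trans b1
  -- first factor
  have s1 : Real.sqrt (32 * A₁) ≤ Real.sqrt (32 * A) := Real.sqrt_le_sqrt (by linarith)
  have s2 : Real.sqrt (32 * A₂) ≤ Real.sqrt (32 * A) := Real.sqrt_le_sqrt (by linarith)
  have p12 : Real.sqrt (32 * A₁) * Real.sqrt (32 * A₂) ≤ Real.sqrt (32 * A) * Real.sqrt (32 * A) :=
    mul_le_mul s1 s2 (Real.sqrt_nonneg _) (Real.sqrt_nonneg _)
  have q12 : Real.sqrt (Real.sqrt (32 * A₁) * Real.sqrt (32 * A₂)) ≤ Real.sqrt 32 * Real.sqrt A := by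
    refine (Real.sqrt_le_sqrt p12).trans (le_of_eq ?_)
    rw [Real.sqrt_mul_self (Real.sqrt_nonneg _), Real.sqrt_mul (by norm_num : (0:ℝ) ≤ 32)]
  -- second factor
  have s4 : Real.sqrt (32 * A₄) ≤ Real.sqrt 32 * v ^ 2 := by
    rw [Real.sqrt_le_left (by positivity)]; nlinarith [hsq32, sq_nonneg v]
  have s3 : Real.sqrt (32 * A₃) ≤ Real.sqrt (32 * u) := Real.sqrt_le_sqrt (by linarith)
  have p34 : Real.sqrt (32 * A₃) * Real.sqrt (32 * A₄) ≤ Real.sqrt (32 * u) * (Real.sqrt 32 * v ^ 2) :=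
    mul_le_mul s3 s4 (Real.sqrt_nonneg _) (Real.sqrt_nonneg _)
  have q34 : Real.sqrt (Real.sqrt (32 * A₃) * Real.sqrt (32 * A₄)) ≤ Real.sqrt 32 * (Real.sqrt (Real.sqrt u) * v) := by
    refine (Real.sqrt_le_sqrt p34).trans (le_of_eq ?_)
    exact sqrt_sqrt_mul_eq hv
  have h := mul_le_mul q12 q34 (Real.sqrt_nonneg _) (by positivity)
  have e : Real.sqrt 32 * Real.sqrt A * (Real.sqrt 32 * (Real.sqrt (Real.sqrt u) * v)) = 32 * Real.sqrt A * (Real.sqrt (Real.sqrt u) * v) := by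
    calc Real.sqrt 32 * Real.sqrt A * (Real.sqrt 32 * (Real.sqrt (Real.sqrt u) * v))
        = (Real.sqrt 32 * Real.sqrt 32) * Real.sqrt A * (Real.sqrt (Real.sqrt u) * v) := by ring
      _ = _ := by rw [hsq32]
  rw [e] at h
  linarith

/-- ★★ **ROW R4′ of LEAD g78's K4′(b) term table** (CENTRED plaquette slots; N generic).  With `C_P`, `C_A` from w5 g24's ✓p754004: for `H ≥ 1`, `β ≥ 1`, `0 ≤ s ≤ 1`,
any `|Tc| ≤ B`, any measurable `D ⊆ smallField H s` with `E₀[1 − 1_D] ≤ τ ≤ 1/2`, any measurable `N` with `|N| ≤ ν` on `D` (`ν ≥ 0`) and all `x y`, in the CROSS letter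
of ✓`GaussRestrict.tiltCum4_muSet_zero_add_third` with `E := Tilt.tiltExp μ_D P 0` (`P` FIRST):
`|CROSS_P(c_x, c_y; P, N)| ≤ 128·√(C_P·((1+log H)⁴/β⁴ + s⁶/β³))·(√(√(C_A·(B²H⁴(1+log H)³/β)²))·ν)`.
REL rows at `κ₃ = 1/8 − θ/4`: `15.25θ − 1.625 < 0` (ghost ν), `12.75θ − 1.375 < 0` (quintic ν) — both ✓ for every `θ < 1/10`. -/
theorem abs_cross_muSet_rowR4_centred_le : ∃ CP CA : ℝ, 0 ≤ CP ∧ 0 ≤ CA ∧ ∀ H : ℕ, 1 ≤ H → ∀ β : ℝ, 1 ≤ β → ∀ s : ℝ, 0 ≤ s → s ≤ 1 →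
    ∀ B : ℝ, ∀ Tc : ZdPlaquette 4 → Fin 4 → Fin 4 → Fin 4 → ℝ, (∀ p i j k, |Tc p i j k| ≤ B) →
    ∀ D : Set (LandauFree H → E3), MeasurableSet D → D ⊆ smallField H s →
    ∀ τ : ℝ, gaussAvg β H (fun a => 1 - D.indicator (fun _ => (1 : ℝ)) a) ≤ τ → τ ≤ 1 / 2 →
    ∀ N : (LandauFree H → E3) → ℝ, Measurable N → ∀ ν : ℝ, 0 ≤ ν → (∀ a ∈ D, |N a| ≤ ν) → ∀ x y : Site 4,
      let μD : Measure (LandauFree H → E3) := ((volume : Measure (LandauFree H → E3)).restrict D).withDensity fun a => ENNReal.ofReal (gaussWeight β H a)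
      let P : (LandauFree H → E3) → ℝ := fun a => β * ∑ p ∈ plaquettesTouching (boxEdges 4 (2 * H + 1)), tripleForm (Tc p) (plaqVar H p.1 p.2.1.1 p.2.1.2 a)
      let E : ((LandauFree H → E3) → ℝ) → ℝ := fun G => Tilt.tiltExp μD P 0 G
      let X : (LandauFree H → E3) → ℝ := chartPlaqCost H x 1 2
      let Y : (LandauFree H → E3) → ℝ := chartPlaqCost H y 1 2
      |E (fun a => (X a - E X) * (Y a - E Y) * (P a - E P) * (N a - E N)) - E (fun a => (X a - E X) * (Y a - E Y)) * E (fun a => (P a - E P) * (N a - E N))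
          - E (fun a => (X a - E X) * (P a - E P)) * E (fun a => (Y a - E Y) * (N a - E N))
          - E (fun a => (X a - E X) * (N a - E N)) * E (fun a => (Y a - E Y) * (P a - E P))| ≤
        128 * Real.sqrt (CP * ((1 + Real.log H) ^ 4 / β ^ 4 + s ^ 6 / β ^ 3)) *
          (Real.sqrt (Real.sqrt (CA * (B ^ 2 * (H : ℝ) ^ 4 * (1 + Real.log H) ^ 3 / β) ^ 2)) * ν) := by
  obtain ⟨CP, hCP0, hXm⟩ := gaussAvg_indicator_mul_chartPlaqCost_sub_mean_pow_four_le
  obtain ⟨CA, hCA0, hPm⟩ := gaussAvg_indicator_mul_tripleFormSum_pow_four_le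
  refine ⟨CP, CA, hCP0, hCA0, fun H hH β hβ1 s hs0 hs1 B Tc hTc D hDm hDs τ hτ hτ2 N mN ν hν bN x y => ?_⟩
  have hβ : 0 < β := lt_of_lt_of_le one_pos hβ1
  intro μD P E X Y
  set PT := plaquettesTouching (boxEdges 4 (2 * H + 1)) with hPT
  -- sup bounds on `D` (qualitative, for fcl-p3's lemma)
  have hXb : ∀ z : Site 4, ∀ a ∈ D, |chartPlaqCost H z 1 2 a| ≤ 116 * s ^ 2 := fun z a ha => TiltSup.abs_chartPlaqCost_le hs0 hs1 (hDs ha) z 1 2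
  have hPb : ∀ a ∈ D, |P a| ≤ β * PT.card * (6 * B * (4 * s) ^ 3) := by
    intro a ha
    show |β * ∑ p ∈ PT, tripleForm (Tc p) (plaqVar H p.1 p.2.1.1 p.2.1.2 a)| ≤ _
    rw [abs_mul, abs_of_pos hβ]
    have hterm : ∀ p ∈ PT, |tripleForm (Tc p) (plaqVar H p.1 p.2.1.1 p.2.1.2 a)| ≤ 6 * B * (4 * s) ^ 3 := by
      intro p _
      refine (EdgeChartGaussian.abs_tripleForm_le (Tc p) (hTc p) _).trans ?_
      have hB : 0 ≤ B := (abs_nonneg _).trans (hTc p 0 0 0)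
      exact mul_le_mul_of_nonneg_left (pow_le_pow_left₀ (Finset.sum_nonneg fun i _ => norm_nonneg _)
        (TiltSup.sum_norm_plaqVar_le hs0 (hDs ha) p.1 p.2.1.1 p.2.1.2) 3) (by positivity)
    have hsum : |∑ p ∈ PT, tripleForm (Tc p) (plaqVar H p.1 p.2.1.1 p.2.1.2 a)| ≤ PT.card * (6 * B * (4 * s) ^ 3) := by
      refine (Finset.abs_sum_le_sum_abs _ _).trans ((Finset.sum_le_sum hterm).trans (le_of_eq ?_))
      rw [Finset.sum_const, nsmul_eq_mul]
    calc β * |∑ p ∈ PT, tripleForm (Tc p) (plaqVar H p.1 p.2.1.1 p.2.1.2 a)| ≤ β * (PT.card * (6 * B * (4 * s) ^ 3)) :=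
        mul_le_mul_of_nonneg_left hsum hβ.le
      _ = _ := by ring
  set Bc : ℝ := max (max (116 * s ^ 2) ν) (β * PT.card * (6 * B * (4 * s) ^ 3)) with hBc
  have hBc0 : 0 ≤ Bc := le_max_of_le_left (le_max_of_le_left (by positivity))
  have bX : ∀ a ∈ D, |X a| ≤ Bc := fun a ha => (hXb x a ha).trans ((le_max_left _ _).trans (le_max_left _ _))
  have bY : ∀ a ∈ D, |Y a| ≤ Bc := fun a ha => (hXb y a ha).trans ((le_max_left _ _).trans (le_max_left _ _))
  have bN' : ∀ a ∈ D, |N a| ≤ Bc := fun a ha => (bN a ha).trans ((le_max_right _ _).trans (le_max_left _ _))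
  have bP : ∀ a ∈ D, |P a| ≤ Bc := fun a ha => (hPb a ha).trans (le_max_right _ _)
  -- measurability
  have hPc := EdgeChartGaussian.polyCert_tripleFormSum H β PT Tc hTc
  have mP : Measurable P := EdgeChartGaussian.measurable_of_polyCert hPc
  have mX : Measurable X := EdgeChartGaussian.measurable_chartPlaqCost H x 1 2
  have mY : Measurable Y := EdgeChartGaussian.measurable_chartPlaqCost H y 1 2
  -- fcl-p3's CROSS bound at `(U, V) = (P, N)`, plaquette slots re-centred at the Gaussian means of `ℓ²`
  have hc := GaussRestrict.abs_cross_muSet_zero_le_gaussAvg hβ hDm hτ hτ2 hBc0 mX mY mP mN bX bY bP bN'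
    (gaussAvg β H (linCurvSq H (plaq12At x))) (gaussAvg β H (linCurvSq H (plaq12At y))) 0 0
  dsimp only at hc
  -- the fourth moments
  have A1 := hXm H hH β hβ1 s hs0 hs1 D hDs x
  have A2 := hXm H hH β hβ1 s hs0 hs1 D hDs y
  have A3 := hPm H hH β hβ B Tc hTc D
  have A4 := gaussAvg_indicator_mul_pow_four_le_of_bdd hβ hDm mN bN
  have n0 : ∀ (F : (LandauFree H → E3) → ℝ) (c : ℝ), 0 ≤ gaussAvg β H (fun a => D.indicator (fun _ => (1 : ℝ)) a * (F a - c) ^ 4) := fun F c =>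
    EdgeChartGaussian.gaussAvg_nonneg H hβ fun a => mul_nonneg (GaussRestrict.indicator_one_nonneg_le_one D a).1 (by positivity)
  have hss := sqrt_sqrt_bound' (n0 _ _) (n0 _ _) hν A1 A2 A3 A4
  exact hc.trans hss

end GaussNormalForm

end Summit.QuantumFields.YangMills.Theorems.AllWindowsColdBoxBoxHighLine

end
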